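import Summits.Ventures.HodgeRepro2.T5BergmanCoefficientVanish
import Summits.Ventures.HodgeRepro2.T5SU11HyperbolicSubgroup
import Summits.Ventures.HodgeRepro2.T5SU11UnipotentSubgroup

/-!
# `π_k` has no non-zero invariant vectors (a Howe–Moore-type corollary of `C₀`)

`SU(1,1)` is not compact (`noncompactSpace_SU11`: `|a(g)|` takes every value `R ≥ 1`, on
`g = su11 R √(R²-1)` — `exists_norm_mat_eq`), so its cocompact filter is non-trivial and the `C₀`
property of `T5BergmanCoefficientVanish` has teeth: a holomorphic `f ∈ A_k` (`k ≥ 2`) fixed by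
`π_k(g)` on the disc for every `g` has a CONSTANT coefficient `⟨π_k(g) f, f⟩_k = ⟨f,f⟩_k` which must tend
to `0` at infinity, hence `⟨f,f⟩_k = 0` and `f = 0` on the disc (`pairing_self_eq_zero_of_act_eq`,
`eq_zero_of_act_eq`). The same holds for a vector fixed by any PROPER family of group elements — in
particular by any closed non-compact subgroup `H ≤ SU(1,1)` (`pairing_self_eq_zero_of_act_eq_of_subgroup`,
the Howe–Moore form: vectors fixed by a non-compact closed subgroup vanish), concretely by the
hyperbolic one-parameter subgroup `{a_t}` of `T5SU11HyperbolicSubgroup` (`eq_zero_of_act_hyp_eq`) and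
by the unipotent one-parameter subgroup `{n_t}` of `T5SU11UnipotentSubgroup` (`eq_zero_of_act_unip_eq`)
— and on `H_j = U(1,1)` (`pairing_self_eq_zero_of_actU_eq`). Nothing is claimed about (N).

Blind lane: Mathlib + the HodgeRepro2 prefix only; no sorry; axioms ⊆ {propext, Classical.choice,
Quot.sound}.
-/

namespace Summit.Ventures.HodgeRepro2.T5BergmanNoInvariantVector

open MeasureTheory Metric Filter Topology Set
open T5PoincareDensity T5PoincareMeasure T5SU11Unimodular T5U11Unimodular T5U11Product
  T5SU11Fibration T5SU11Cartan T5SU11HyperbolicSubgroup T5SU11UnipotentSubgroup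
open T5BergmanCoefficient T5BergmanPairing T5BergmanUnitary T5BergmanPointwise T5BergmanFourier
  T5BergmanParseval T5BergmanActStable T5BergmanMatrixCoeff T5BergmanU11 T5BergmanSchurGeneralU11
  T5BergmanCoefficientVanish
open scoped Real

/-! ### `SU(1,1)` is not compact -/

/-- For every `R ≥ 1` there is `g ∈ SU(1,1)` with `|a(g)| = R`: `g = su11 R √(R²-1)`. -/
theorem exists_norm_mat_eq (R : ℝ) (hR : 1 ≤ R) : ∃ g : SU11, ‖mat g 0 0‖ = R := by
  have h : Complex.normSq (R : ℂ) - Complex.normSq ((Real.sqrt (R ^ 2 - 1) : ℝ) : ℂ) = 1 := by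
    rw [Complex.normSq_ofReal, Complex.normSq_ofReal, Real.mul_self_sqrt (by nlinarith)]
    ring
  refine ⟨toSU11 (R : ℂ) ((Real.sqrt (R ^ 2 - 1) : ℝ) : ℂ) h, ?_⟩
  show ‖((toSU11 _ _ h : Matrix.SpecialLinearGroup (Fin 2) ℂ) : Matrix (Fin 2) (Fin 2) ℂ) 0 0‖ = R
  rw [coe_toSU11]
  simp [su11, abs_of_pos (by linarith : (0 : ℝ) < R)]

/-- **`SU(1,1)` is not compact**: `g ↦ |a(g)|` is continuous and unbounded. -/
instance noncompactSpace_SU11 : NoncompactSpace SU11 := by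
  refine ⟨fun hc => ?_⟩
  obtain ⟨B, hB⟩ := hc.bddAbove_image (continuous_norm.comp (continuous_mat_apply 0 0)).continuousOn
  obtain ⟨g, hg⟩ := exists_norm_mat_eq (max B 1 + 1) (by linarith [le_max_right B 1])
  have h1 : ‖mat g 0 0‖ ≤ B := hB ⟨g, mem_univ g, rfl⟩
  rw [hg] at h1
  linarith [le_max_left B 1]

/-- The cocompact filter of `SU(1,1)` is non-trivial. -/
theorem cocompact_neBot : (cocompact SU11).NeBot := inferInstance

/-! ### Invariant vectors -/

/-- The coefficient of a vector fixed by `π_k(g)` on the disc is `⟨f,f⟩_k`. -/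
theorem matrixCoeff_eq_of_act_eq (k : ℕ) (f : ℂ → ℂ) (g : SU11)
    (hinv : ∀ z ∈ ball (0 : ℂ) 1, act k g f z = f z) : matrixCoeff k f f g = pairing k f f := by
  unfold matrixCoeff
  exact pairing_congr hinv (fun _ _ => rfl)

/-- **Vectors fixed by a proper family of group elements vanish**: if `e : X → SU(1,1)` carries the
cocompact filter of a non-compact space `X` to that of `SU(1,1)` and `π_k(e x) f = f` on the disc for
every `x`, then `⟨f,f⟩_k = 0` (the constant coefficient must vanish at infinity). -/
theorem pairing_self_eq_zero_of_act_eq_of_tendsto {X : Type*} [TopologicalSpace X]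
    [NoncompactSpace X] (e : X → SU11) (he : Tendsto e (cocompact X) (cocompact SU11)) (k : ℕ)
    (hk : 2 ≤ k) (f : ℂ → ℂ) (hf : DifferentiableOn ℂ f (ball 0 1))
    (hfint : IntegrableOn (fun w => ‖f w‖ ^ 2 * (1 - ‖w‖ ^ 2) ^ (k - 2)) (ball (0 : ℂ) 1))
    (hinv : ∀ x, ∀ z ∈ ball (0 : ℂ) 1, act k (e x) f z = f z) : pairing k f f = 0 := by
  have h := (tendsto_matrixCoeff_cocompact_of_differentiableOn k hk f hf hfint f hf hfint).comp he
  have e' : (matrixCoeff k f f ∘ e) = fun _ => pairing k f f := by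
    funext x
    exact matrixCoeff_eq_of_act_eq k f (e x) (hinv x)
  rw [e'] at h
  exact tendsto_const_nhds_iff.1 h

/-- **No non-zero invariant vectors**: a holomorphic `f ∈ A_k` (`k ≥ 2`) with `π_k(g) f = f` on the disc
for every `g ∈ SU(1,1)` has `⟨f,f⟩_k = 0`. -/
theorem pairing_self_eq_zero_of_act_eq (k : ℕ) (hk : 2 ≤ k) (f : ℂ → ℂ)
    (hf : DifferentiableOn ℂ f (ball 0 1))
    (hfint : IntegrableOn (fun w => ‖f w‖ ^ 2 * (1 - ‖w‖ ^ 2) ^ (k - 2)) (ball (0 : ℂ) 1))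
    (hinv : ∀ (g : SU11), ∀ z ∈ ball (0 : ℂ) 1, act k g f z = f z) : pairing k f f = 0 :=
  pairing_self_eq_zero_of_act_eq_of_tendsto id tendsto_id k hk f hf hfint hinv

/-- … and such an `f` vanishes on the disc. -/
theorem eq_zero_of_act_eq (k : ℕ) (hk : 2 ≤ k) (f : ℂ → ℂ) (hf : DifferentiableOn ℂ f (ball 0 1))
    (hfint : IntegrableOn (fun w => ‖f w‖ ^ 2 * (1 - ‖w‖ ^ 2) ^ (k - 2)) (ball (0 : ℂ) 1))
    (hinv : ∀ (g : SU11), ∀ z ∈ ball (0 : ℂ) 1, act k g f z = f z) {z : ℂ}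
    (hz : z ∈ ball (0 : ℂ) 1) : f z = 0 :=
  eq_zero_of_pairing_self_eq_zero k f hf hfint
    (pairing_self_eq_zero_of_act_eq k hk f hf hfint hinv) hz

/-- **Howe–Moore form**: a vector fixed (on the disc) by every element of a closed non-compact subgroup
`H ≤ SU(1,1)` has `⟨f,f⟩_k = 0`. -/
theorem pairing_self_eq_zero_of_act_eq_of_subgroup (H : Subgroup SU11)
    (hH : IsClosed (H : Set SU11)) [NoncompactSpace H] (k : ℕ) (hk : 2 ≤ k) (f : ℂ → ℂ)
    (hf : DifferentiableOn ℂ f (ball 0 1))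
    (hfint : IntegrableOn (fun w => ‖f w‖ ^ 2 * (1 - ‖w‖ ^ 2) ^ (k - 2)) (ball (0 : ℂ) 1))
    (hinv : ∀ g ∈ H, ∀ z ∈ ball (0 : ℂ) 1, act k g f z = f z) : pairing k f f = 0 :=
  pairing_self_eq_zero_of_act_eq_of_tendsto (X := H) (fun x => (x : SU11))
    hH.isClosedEmbedding_subtypeVal.tendsto_cocompact k hk f hf hfint fun x => hinv x x.2

/-- … and such an `f` vanishes on the disc. -/
theorem eq_zero_of_act_eq_of_subgroup (H : Subgroup SU11) (hH : IsClosed (H : Set SU11))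
    [NoncompactSpace H] (k : ℕ) (hk : 2 ≤ k) (f : ℂ → ℂ) (hf : DifferentiableOn ℂ f (ball 0 1))
    (hfint : IntegrableOn (fun w => ‖f w‖ ^ 2 * (1 - ‖w‖ ^ 2) ^ (k - 2)) (ball (0 : ℂ) 1))
    (hinv : ∀ g ∈ H, ∀ z ∈ ball (0 : ℂ) 1, act k g f z = f z) {z : ℂ} (hz : z ∈ ball (0 : ℂ) 1) :
    f z = 0 :=
  eq_zero_of_pairing_self_eq_zero k f hf hfint
    (pairing_self_eq_zero_of_act_eq_of_subgroup H hH k hk f hf hfint hinv) hz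

/-! ### The hyperbolic subgroup `{a_t}` -/

/-- **No non-zero vector of `A_k` is fixed by the hyperbolic one-parameter subgroup**: if
`π_k(a_t) f = f` on the disc for every `t ∈ ℝ` (`a_t = su11 (cosh t) (sinh t)`), then `⟨f,f⟩_k = 0`. -/
theorem pairing_self_eq_zero_of_act_hyp_eq (k : ℕ) (hk : 2 ≤ k) (f : ℂ → ℂ)
    (hf : DifferentiableOn ℂ f (ball 0 1))
    (hfint : IntegrableOn (fun w => ‖f w‖ ^ 2 * (1 - ‖w‖ ^ 2) ^ (k - 2)) (ball (0 : ℂ) 1))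
    (hinv : ∀ t : ℝ, ∀ z ∈ ball (0 : ℂ) 1, act k (hyp t) f z = f z) : pairing k f f = 0 :=
  pairing_self_eq_zero_of_act_eq_of_tendsto hyp tendsto_hyp_cocompact k hk f hf hfint hinv

/-- … and such an `f` vanishes on the disc. -/
theorem eq_zero_of_act_hyp_eq (k : ℕ) (hk : 2 ≤ k) (f : ℂ → ℂ) (hf : DifferentiableOn ℂ f (ball 0 1))
    (hfint : IntegrableOn (fun w => ‖f w‖ ^ 2 * (1 - ‖w‖ ^ 2) ^ (k - 2)) (ball (0 : ℂ) 1))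
    (hinv : ∀ t : ℝ, ∀ z ∈ ball (0 : ℂ) 1, act k (hyp t) f z = f z) {z : ℂ}
    (hz : z ∈ ball (0 : ℂ) 1) : f z = 0 :=
  eq_zero_of_pairing_self_eq_zero k f hf hfint
    (pairing_self_eq_zero_of_act_hyp_eq k hk f hf hfint hinv) hz

/-- The same through the subgroup `A = hypSubgroup` (closed and non-compact). -/
theorem pairing_self_eq_zero_of_act_eq_of_mem_hypSubgroup (k : ℕ) (hk : 2 ≤ k) (f : ℂ → ℂ)
    (hf : DifferentiableOn ℂ f (ball 0 1))
    (hfint : IntegrableOn (fun w => ‖f w‖ ^ 2 * (1 - ‖w‖ ^ 2) ^ (k - 2)) (ball (0 : ℂ) 1))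
    (hinv : ∀ g ∈ hypSubgroup, ∀ z ∈ ball (0 : ℂ) 1, act k g f z = f z) : pairing k f f = 0 :=
  pairing_self_eq_zero_of_act_eq_of_subgroup hypSubgroup isClosed_hypSubgroup k hk f hf hfint hinv

/-! ### The unipotent subgroup `{n_t}` -/

/-- **No non-zero vector of `A_k` is fixed by the unipotent one-parameter subgroup**: if
`π_k(n_t) f = f` on the disc for every `t ∈ ℝ` (`n_t = su11 (1 + i t) (-i t)`), then `⟨f,f⟩_k = 0`. -/
theorem pairing_self_eq_zero_of_act_unip_eq (k : ℕ) (hk : 2 ≤ k) (f : ℂ → ℂ)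
    (hf : DifferentiableOn ℂ f (ball 0 1))
    (hfint : IntegrableOn (fun w => ‖f w‖ ^ 2 * (1 - ‖w‖ ^ 2) ^ (k - 2)) (ball (0 : ℂ) 1))
    (hinv : ∀ t : ℝ, ∀ z ∈ ball (0 : ℂ) 1, act k (unip t) f z = f z) : pairing k f f = 0 :=
  pairing_self_eq_zero_of_act_eq_of_tendsto unip tendsto_unip_cocompact k hk f hf hfint hinv

/-- … and such an `f` vanishes on the disc. -/
theorem eq_zero_of_act_unip_eq (k : ℕ) (hk : 2 ≤ k) (f : ℂ → ℂ)
    (hf : DifferentiableOn ℂ f (ball 0 1))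
    (hfint : IntegrableOn (fun w => ‖f w‖ ^ 2 * (1 - ‖w‖ ^ 2) ^ (k - 2)) (ball (0 : ℂ) 1))
    (hinv : ∀ t : ℝ, ∀ z ∈ ball (0 : ℂ) 1, act k (unip t) f z = f z) {z : ℂ}
    (hz : z ∈ ball (0 : ℂ) 1) : f z = 0 :=
  eq_zero_of_pairing_self_eq_zero k f hf hfint
    (pairing_self_eq_zero_of_act_unip_eq k hk f hf hfint hinv) hz

/-- The same through the subgroup `N = unipSubgroup` (closed and non-compact). -/
theorem pairing_self_eq_zero_of_act_eq_of_mem_unipSubgroup (k : ℕ) (hk : 2 ≤ k) (f : ℂ → ℂ)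
    (hf : DifferentiableOn ℂ f (ball 0 1))
    (hfint : IntegrableOn (fun w => ‖f w‖ ^ 2 * (1 - ‖w‖ ^ 2) ^ (k - 2)) (ball (0 : ℂ) 1))
    (hinv : ∀ g ∈ unipSubgroup, ∀ z ∈ ball (0 : ℂ) 1, act k g f z = f z) : pairing k f f = 0 :=
  pairing_self_eq_zero_of_act_eq_of_subgroup unipSubgroup isClosed_unipSubgroup k hk f hf hfint hinv

/-! ### On `H_j = U(1,1)` -/

/-- A vector fixed by `π_k(g)` on the disc for every `g ∈ U(1,1)` has `⟨f,f⟩_k = 0`. -/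
theorem pairing_self_eq_zero_of_actU_eq (k : ℕ) (hk : 2 ≤ k) (f : ℂ → ℂ)
    (hf : DifferentiableOn ℂ f (ball 0 1))
    (hfint : IntegrableOn (fun w => ‖f w‖ ^ 2 * (1 - ‖w‖ ^ 2) ^ (k - 2)) (ball (0 : ℂ) 1))
    (hinv : ∀ (g : U11), ∀ z ∈ ball (0 : ℂ) 1, actU k g f z = f z) : pairing k f f = 0 :=
  pairing_self_eq_zero_of_act_eq k hk f hf hfint fun g z hz => by
    rw [← actU_incl k g f z]
    exact hinv (incl g) z hz

/-- … and such an `f` vanishes on the disc. -/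
theorem eq_zero_of_actU_eq (k : ℕ) (hk : 2 ≤ k) (f : ℂ → ℂ) (hf : DifferentiableOn ℂ f (ball 0 1))
    (hfint : IntegrableOn (fun w => ‖f w‖ ^ 2 * (1 - ‖w‖ ^ 2) ^ (k - 2)) (ball (0 : ℂ) 1))
    (hinv : ∀ (g : U11), ∀ z ∈ ball (0 : ℂ) 1, actU k g f z = f z) {z : ℂ}
    (hz : z ∈ ball (0 : ℂ) 1) : f z = 0 :=
  eq_zero_of_pairing_self_eq_zero k f hf hfint
    (pairing_self_eq_zero_of_actU_eq k hk f hf hfint hinv) hz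

end Summit.Ventures.HodgeRepro2.T5BergmanNoInvariantVector
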